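import Summits.CriticalPhenomena.PercolationContinuityZ3.Theorems.FK.InfiniteVolumeOneEdgeDLRClosed
import Summits.CriticalPhenomena.PercolationContinuityZ3.Theorems.FK.FreeWiredCoincidence
import Summits.CriticalPhenomena.PercolationContinuityZ3.Theorems.FK.InfiniteVolumeStochasticOrder
import HarnessLib

/-!
# FK-continuity cell, FO-10a: the edge density is an affine function of the nearest-neighbour
# connectivity, and `φ⁰_{p,q} = φ¹_{p,q}` iff the two-point functions agree at ONE lattice edge
# (Grimmett 2006, eq. (4.88) ⇒ `h⁰ = h¹` ⇒ Thm. (4.63): the second step of the proof of Prop. (4.85))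

Registered R81 (cell INBOX l.5913, 2026-08-23); registry row FO-10a-g337; label CRT-A (coordinator fk-4 g175).
Cell `fk-continuity` (bschramm), row FO-10a (domain-Markov + comparison layer over FO-06); support file for the
FK-continuity transplant (`--supports stmt-CriticalPhenomena-4575`); builds on p205010 (kernel theorem, internal audit
signed; external expert review pending). Pure proofs; no definitions, no named facts, no sorries; general `d`.

Notation: `J_e = {ω | e ∈ ω}` (the lattice edge `e = ⟨x,y⟩` is open), `K_e = {x ↔ y in ω ∖ e}`
(`(· \ {e}) ⁻¹' openConn x y`), `τ_P(x,y) = P(x ↔ y) = P.real (openConn x y)` (two-point / connectivity function),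
`h⁰ = freeEdgeDensity`, `h¹ = wiredEdgeDensity`, `φ^b_{p,q} = rcLimit d b p q`.

* `compl_openConn_eq_inter_of_ne` — `{x ↮ y} = J_eᶜ ∩ K_eᶜ` (deterministic).
* **`IsBoxLimit.real_edgeOpen_eq_div_add_mul_real_openConn`** — for every box limit `P` (`0 ≤ p ≤ 1`, `q ≥ 1`,
  either boundary condition) and every lattice edge `e = ⟨x,y⟩`:
  `P(J_e) = p/q + p(1 - q⁻¹) · τ_P(x,y)`.
  Proof: the one-edge DLR equation (Grimmett (4.38), tree `IsBoxLimit.real_edgeOpen_inter_eq` with `H = Ω`) gives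
  `P(J_e) = p·P(K_e) + π·P(K_eᶜ)` and `P(J_e ∩ K_eᶜ) = π·P(K_eᶜ)` with `π = p/(p + q(1-p))`; hence
  `P(x ↮ y) = (1 - π)·P(K_eᶜ)` and `P(J_e) = p - (p - π)·P(K_eᶜ)`, and `p - π = p(1 - q⁻¹)(1 - π)`.
  (For integer `q` this is the Edwards–Sokal reading `P(e open) = p · P(σ_x = σ_y)` with
  `P(σ_x = σ_y) = q⁻¹ + (1 - q⁻¹) τ(x,y)`; here for every real `q ≥ 1`.) The FINITE-VOLUME identity
  `q·φ^B_{G,p,q}(e open) = p·(1 + (q − 1)·φ^B_{G,p,q}(u ↔ v, B wired))` (Grimmett Thm. (3.1)(a) eq. (3.3)) is the tree's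
  Literature lemma `Literature.Probability.LatticeModels.rcMeasure_real_edgeOpen_eq_of_adj`
  (`FKIsingEdgeDensityDictionary.lean`); the statement here is its INFINITE-VOLUME form for the limit measures, obtained
  not by passing to the limit (the event `{x ↔ y}` is not local) but from the one-edge DLR equation (4.38).
* `freeEdgeDensity_eq_div_add_mul_real_openConn`, `wiredEdgeDensity_eq_div_add_mul_real_openConn` — the same for
  `h⁰(p,q)(e)`, `h¹(p,q)(e)`; `wiredEdgeDensity_sub_freeEdgeDensity_eq` —
  `h¹(e) - h⁰(e) = p(1 - q⁻¹)·(τ¹(x,y) - τ⁰(x,y))`: the latent heat at `e` IS the jump of the nearest-neighbour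
  connectivity, up to the factor `p(1 - q⁻¹)`.
* HEADLINE **`rcLimit_false_eq_rcLimit_true_iff_real_openConn_eq (hp : p ∈ Icc 0 1) (hq : 1 ≤ q)
  (hxy : (zdGraph d).Adj x y) : φ⁰_{p,q} = φ¹_{p,q} ↔ τ⁰(x,y) = τ¹(x,y)`** — uniqueness of the random-cluster
  measure is decided by the two-point function at a single pair of neighbours (Grimmett's (4.88) ⇒ `h⁰ = h¹` ⇒
  Thm. (4.63); the converse is trivial); `rcLimit_false_eq_rcLimit_true_iff_forall_real_openConn_eq` (`d ≥ 1`):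
  `φ⁰_{p,q} = φ¹_{p,q}` iff the two-point functions coincide everywhere;
  `real_openConn_lt_of_rcLimit_false_ne_rcLimit_true` — at a point of phase coexistence `τ⁰(x,y) < τ¹(x,y)` for
  EVERY pair of neighbours.

Honest framing: UNCONDITIONAL infinite-volume structure (every `d`, `q ≥ 1`, `0 ≤ p ≤ 1`); it decides nothing about
`q ∈ (1,2)` at `p_c(q)`; NOT a binder discharge, NOT `_r4`; `_r3` « 2 / 0 ☑ », n_open = 2 unchanged.

## References

* G. Grimmett, *The Random-Cluster Model*, Springer 2006 (`book:grimmett2006-random-cluster-model`): Prop. (4.37)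
  eq. (4.38) [PDF p. 83]; proof of Prop. (4.85), second step, eq. (4.88) [PDF p. 95]; Thm. (4.63) [PDF p. 89];
  Prop. (4.6) [PDF p. 70]. [Grimmett2006]
-/

noncomputable section

open MeasureTheory Set Filter
open scoped Topology ENNReal

namespace Summit.CriticalPhenomena.PercolationContinuityZ3.Theorems.FK

open Literature.Probability.Percolation Literature.Probability.LatticeModels

variable {d : ℕ}

/-! ### `{x ↮ y} = {e closed} ∩ K_eᶜ` -/

section Deterministic

variable {V : Type*}

/-- **`{x ↮ y} = J_eᶜ ∩ K_eᶜ`** for `e = ⟨x,y⟩`, `x ≠ y`: `x` and `y` are NOT joined iff the edge `⟨x,y⟩` is closed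
and they are not joined off that edge. [cite: Grimmett2006, proof of Prop. (4.85), p. 95 (the events J_e, K_e)] -/
theorem compl_openConn_eq_inter_of_ne {x y : V} (hxy : x ≠ y) :
    (openConn x y)ᶜ =
      {ω : BondConfig V | s(x, y) ∉ ω} ∩ ((fun η : BondConfig V => η \ {s(x, y)}) ⁻¹' openConn x y)ᶜ := by
  ext ω
  simp only [mem_compl_iff, mem_inter_iff, mem_setOf_eq, mem_preimage, openConn]
  constructor
  · intro h
    have he : s(x, y) ∉ ω := fun he => h (SimpleGraph.Adj.reachable ((openGraph_adj ω x y).2 ⟨he, hxy⟩))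
    refine ⟨he, ?_⟩
    rwa [sdiff_singleton_eq_self he]
  · rintro ⟨he, h⟩
    rwa [sdiff_singleton_eq_self he] at h

end Deterministic

/-! ### The affine identity `P(e open) = p/q + p(1 - q⁻¹)·P(x ↔ y)` for box limits -/

section BoxLimit

variable {b : Bool} {p q : ℝ} {P : Measure (BondConfig (Site d))}

/-- The algebra of Grimmett's (4.38): with `π = p/(p + q(1-p))`, `p - π = p(1 - q⁻¹)(1 - π)` (`0 ≤ p ≤ 1`, `q > 0`).
[cite: Grimmett2006, proof of Prop. (4.85), p. 95] -/
theorem sub_div_eq_mul_one_sub_div (hp : p ∈ Set.Icc (0 : ℝ) 1) (hq : 0 < q) :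
    p - p / (p + q * (1 - p)) = p * (1 - q⁻¹) * (1 - p / (p + q * (1 - p))) := by
  have hq0 : q ≠ 0 := hq.ne'
  have hD : 0 < p + q * (1 - p) := by
    rcases eq_or_lt_of_le hp.2 with h | h
    · rw [h]; norm_num
    · exact add_pos_of_nonneg_of_pos hp.1 (mul_pos hq (by linarith))
  field_simp
  ring

/-- **`P(J_e) = p/q + p(1 - q⁻¹)·P(x ↔ y)` for every box limit** (`0 ≤ p ≤ 1`, `q ≥ 1`, either boundary
condition, every lattice edge `e = ⟨x,y⟩`): the edge density is an affine function of the nearest-neighbour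
connectivity. From the one-edge DLR equation (4.38). [cite: Grimmett2006, Prop. (4.37) eq. (4.38); proof of Prop. (4.85), p. 95] -/
theorem IsBoxLimit.real_edgeOpen_eq_div_add_mul_real_openConn (hP : IsBoxLimit d b p q P)
    (hp : p ∈ Set.Icc (0 : ℝ) 1) (hq : 1 ≤ q) {x y : Site d} (hxy : (zdGraph d).Adj x y) :
    P.real {ω | s(x, y) ∈ ω} = p / q + p * (1 - q⁻¹) * P.real (openConn x y) := by
  haveI := hP.isProbabilityMeasure
  have hH : DeterminedBy (Set.univ : Set (BondConfig (Site d))) (↑(∅ : Finset (Sym2 (Site d)))) :=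
    determinedBy_univ _
  -- (4.38) with `H = Ω`: `P(J_e) = p·P(K_e) + π·P(K_eᶜ)` and `P(J_e ∩ K_eᶜ) = π·P(K_eᶜ)`
  have h1 := hP.real_edgeOpen_inter_eq hp hq hxy hH (Finset.notMem_empty _)
  have h2 := hP.real_edgeOpen_inter_not_offEdgeConn_eq_mul hp hq hxy hH (Finset.notMem_empty _)
  simp only [Set.inter_univ, Set.univ_inter] at h1 h2
  set K : Set (BondConfig (Site d)) := (fun η : BondConfig (Site d) => η \ {s(x, y)}) ⁻¹' openConn x y
    with hK
  have hKm : MeasurableSet K := (measurableSet_openConn_holds x y).preimage (measurable_closeEdges _)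
  have hJm : MeasurableSet {ω : BondConfig (Site d) | s(x, y) ∈ ω} :=
    measurableSet_of_isLocalEvent_holds (isLocalEvent_setOf_mem _)
  -- `P(x ↮ y) = P(K_eᶜ) - P(J_e ∩ K_eᶜ)`
  have h3 : P.real (openConn x y)ᶜ = P.real Kᶜ - P.real ({ω | s(x, y) ∈ ω} ∩ Kᶜ) := by
    rw [compl_openConn_eq_inter_of_ne hxy.ne, ← hK]
    have : {ω : BondConfig (Site d) | s(x, y) ∉ ω} ∩ Kᶜ = Kᶜ \ ({ω | s(x, y) ∈ ω} ∩ Kᶜ) := by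
      ext ω; simp only [mem_inter_iff, mem_setOf_eq, Set.mem_sdiff, mem_compl_iff]; tauto
    rw [this, measureReal_sdiff Set.inter_subset_right (hJm.inter hKm.compl)]
  have hKc : P.real Kᶜ = 1 - P.real K := probReal_compl_eq_one_sub hKm
  have hOc : P.real (openConn x y)ᶜ = 1 - P.real (openConn x y) :=
    probReal_compl_eq_one_sub (measurableSet_openConn_holds x y)
  have halg := sub_div_eq_mul_one_sub_div hp (one_pos.trans_le hq)
  linear_combination h1 + p * hKc - p * (1 - q⁻¹) * hOc + p * (1 - q⁻¹) * h3 - p * (1 - q⁻¹) * h2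
    - P.real Kᶜ * halg

/-- **`h⁰(p,q)(e) = p/q + p(1 - q⁻¹)·φ⁰_{p,q}(x ↔ y)`** (`e = ⟨x,y⟩` a lattice edge, `0 ≤ p ≤ 1`, `q ≥ 1`).
[cite: Grimmett2006, Prop. (4.37) eq. (4.38); proof of Prop. (4.85), p. 95] -/
theorem freeEdgeDensity_eq_div_add_mul_real_openConn (hp : p ∈ Set.Icc (0 : ℝ) 1) (hq : 1 ≤ q)
    {x y : Site d} (hxy : (zdGraph d).Adj x y) :
    freeEdgeDensity d p q s(x, y) = p / q + p * (1 - q⁻¹) * (rcLimit d false p q).real (openConn x y) := by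
  rw [← (isBoxLimit_rcLimit false hp hq).real_setOf_mem_eq_freeEdgeDensity hp hq]
  exact (isBoxLimit_rcLimit false hp hq).real_edgeOpen_eq_div_add_mul_real_openConn hp hq hxy

/-- A lattice edge witnesses `d ≥ 1`. [folklore] -/
theorem pos_of_adj {x y : Site d} (hxy : (zdGraph d).Adj x y) : 0 < d := by
  obtain ⟨i, -⟩ := (zdGraph_adj_iff x y).1 hxy
  exact i.pos

/-- **`h¹(p,q)(e) = p/q + p(1 - q⁻¹)·φ¹_{p,q}(x ↔ y)`** (`e = ⟨x,y⟩` a lattice edge, `0 ≤ p ≤ 1`, `q ≥ 1`).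
[cite: Grimmett2006, Prop. (4.37) eq. (4.38); proof of Prop. (4.85), p. 95] -/
theorem wiredEdgeDensity_eq_div_add_mul_real_openConn (hp : p ∈ Set.Icc (0 : ℝ) 1) (hq : 1 ≤ q)
    {x y : Site d} (hxy : (zdGraph d).Adj x y) :
    wiredEdgeDensity d p q s(x, y) = p / q + p * (1 - q⁻¹) * (rcLimit d true p q).real (openConn x y) := by
  rw [← (isBoxLimit_rcLimit true hp hq).real_setOf_mem_eq_wiredEdgeDensity (pos_of_adj hxy) hp hq]
  exact (isBoxLimit_rcLimit true hp hq).real_edgeOpen_eq_div_add_mul_real_openConn hp hq hxy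

/-- **The latent heat is the jump of the nearest-neighbour connectivity**:
`h¹(e) - h⁰(e) = p(1 - q⁻¹)·(φ¹(x ↔ y) - φ⁰(x ↔ y))`. [cite: Grimmett2006, proof of Prop. (4.85), p. 95, with Thm. (4.63)] -/
theorem wiredEdgeDensity_sub_freeEdgeDensity_eq (hp : p ∈ Set.Icc (0 : ℝ) 1) (hq : 1 ≤ q)
    {x y : Site d} (hxy : (zdGraph d).Adj x y) :
    wiredEdgeDensity d p q s(x, y) - freeEdgeDensity d p q s(x, y) =
      p * (1 - q⁻¹) * ((rcLimit d true p q).real (openConn x y) - (rcLimit d false p q).real (openConn x y)) := by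
  rw [wiredEdgeDensity_eq_div_add_mul_real_openConn hp hq hxy,
    freeEdgeDensity_eq_div_add_mul_real_openConn hp hq hxy]
  ring

end BoxLimit

/-! ### Uniqueness iff equal nearest-neighbour connectivity -/

section Uniqueness

variable {p q : ℝ}

/-- **Grimmett's (4.88) ⇒ uniqueness, and conversely: `φ⁰_{p,q} = φ¹_{p,q}` iff `φ⁰_{p,q}(x ↔ y) = φ¹_{p,q}(x ↔ y)`
at ONE pair of neighbours `x ~ y`** (`0 ≤ p ≤ 1`, `q ≥ 1`, every `d`). (⇐): equal connectivities at `⟨x,y⟩` give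
`h⁰(e) = h¹(e)` at `e = ⟨x,y⟩` by the affine identity, and one edge of equal density suffices (Thm. (4.63), tree
`rcLimit_false_eq_rcLimit_true_iff_of_mem_edgeSet`). [cite: Grimmett2006, proof of Prop. (4.85), eq. (4.88), p. 95; Thm. (4.63)] -/
theorem rcLimit_false_eq_rcLimit_true_iff_real_openConn_eq (hp : p ∈ Set.Icc (0 : ℝ) 1) (hq : 1 ≤ q)
    {x y : Site d} (hxy : (zdGraph d).Adj x y) :
    rcLimit d false p q = rcLimit d true p q ↔
      (rcLimit d false p q).real (openConn x y) = (rcLimit d true p q).real (openConn x y) := by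
  refine ⟨fun h => by rw [h], fun h => ?_⟩
  rw [rcLimit_false_eq_rcLimit_true_iff_of_mem_edgeSet hp hq ((zdGraph d).mem_edgeSet.2 hxy),
    freeEdgeDensity_eq_div_add_mul_real_openConn hp hq hxy,
    wiredEdgeDensity_eq_div_add_mul_real_openConn hp hq hxy, h]

/-- **`φ⁰_{p,q} = φ¹_{p,q}` iff the two-point functions coincide everywhere** (`d ≥ 1`, `0 ≤ p ≤ 1`, `q ≥ 1`).
[cite: Grimmett2006, proof of Prop. (4.85), eq. (4.88), p. 95; Thm. (4.63)] -/
theorem rcLimit_false_eq_rcLimit_true_iff_forall_real_openConn_eq (hd : 0 < d) (hp : p ∈ Set.Icc (0 : ℝ) 1)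
    (hq : 1 ≤ q) :
    rcLimit d false p q = rcLimit d true p q ↔
      ∀ x y : Site d, (rcLimit d false p q).real (openConn x y) = (rcLimit d true p q).real (openConn x y) := by
  refine ⟨fun h _ _ => by rw [h], fun h => ?_⟩
  have hxy : (zdGraph d).Adj (0 : Site d) (0 + Pi.single (⟨0, hd⟩ : Fin d) 1) :=
    (zdGraph_adj_iff _ _).2 ⟨⟨0, hd⟩, Or.inl rfl⟩
  exact (rcLimit_false_eq_rcLimit_true_iff_real_openConn_eq hp hq hxy).2 (h _ _)

/-- **At a point of phase coexistence the nearest-neighbour connectivity JUMPS: `φ⁰(x ↔ y) < φ¹(x ↔ y)` for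
every pair of neighbours** (`φ⁰ ≤ φ¹` on the increasing event `{x ↔ y}`, and equality at one edge would force
`φ⁰ = φ¹`). [cite: Grimmett2006, proof of Prop. (4.85), eq. (4.88), p. 95; Thm. (4.63)] -/
theorem real_openConn_lt_of_rcLimit_false_ne_rcLimit_true (hp : p ∈ Set.Icc (0 : ℝ) 1) (hq : 1 ≤ q)
    (hne : rcLimit d false p q ≠ rcLimit d true p q) {x y : Site d} (hxy : (zdGraph d).Adj x y) :
    (rcLimit d false p q).real (openConn x y) < (rcLimit d true p q).real (openConn x y) := by
  refine lt_of_le_of_ne ?_ (fun h => hne ((rcLimit_false_eq_rcLimit_true_iff_real_openConn_eq hp hq hxy).2 h))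
  exact ((isBoxLimit_rcLimit true hp hq).fkGibbs hp hq).rcLimit_false_real_le_of_measurableSet hp hq
    (isUpperSet_openConn x y) (measurableSet_openConn_holds x y)

end Uniqueness

end Summit.CriticalPhenomena.PercolationContinuityZ3.Theorems.FK

end
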